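import Summits.QuantumFields.BalabanUV.T4Continuum.Support.NE7GeodesicSecondOrder
import Summits.QuantumFields.BalabanUV.T4Continuum.Support.SmoothRefineBlocks
import HarnessLib

/-!
# T⁴ programme, row NE7 — (154c) THE GEODESIC IN ITS PARAMETER, THE SMOOTHSTEP `φ(t) = 3t² − 2t³`, AND BLOCK FLOORS
# (`NE7GeodesicParameter`)

Cell `pub-balaban`, lineage `t4-ne7-p2` (CRUX PROVER NE7 #2), gen 86; third file of the kernel chain (154) (road (β′): the C²
corner-gauge interpolation striking THE END's `hflatTop`).  The interpolant fills each block of side `M` of the fine lattice,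
one direction at a time, along the two-point geodesic `t ↦ geo (φ(t∕M)) b₀ b₁` between the values `b₀`, `b₁` at the two
faces of the block, REPARAMETRISED by the smoothstep `φ(t) = 3t² − 2t³`: `φ(0) = 0`, `φ(1) = 1`, `φ′(0) = φ′(1) = 0`, so that
the increments next to a block face are `O(M⁻²)` and the non-commutativity of the generators of two consecutive blocks never
enters a second difference.
§1 the geodesic in its parameter (same unitary endpoints, `‖b₁ − b₀‖ ≤ ρ ≤ 1∕4`): `geo s′ = geo s·(b₀⁻¹b₁)^{s′−s}`,
`‖geo s′ − geo s‖ ≤ 4|s′−s|ρ`, the three-parameter second difference `≤ 4ρ|Δ²s| + (4ρ|Δs|)²`, and the mixed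
parameter∕endpoint second difference `≤ |Δs|·l·(4ρ(1 + 24ρ) + 8)` (over (154b)'s sharp endpoint bound);
§2 the smoothstep: `0 ≤ φ ≤ 1` on `[0,1]`, `0 ≤ φ t′ − φ t ≤ (3∕2)(t′ − t)`, `|φ(t+h) − 2φ(t) + φ(t−h)| ≤ 6h²`,
`φ h ≤ 3h²`, `1 − φ(1−h) ≤ 3h²`, and their lattice forms at `t = r∕M`;
§3 block floors: `fl_j y := y − (res M y j)•e_j` (the tree's `SmoothRefineBlocks.res`), its behaviour under unit steps, coarse
translations and at corners.

HONEST FRAMING (page 1): [folklore] C⋆-algebra calculus and polynomial inequalities; lattice bookkeeping.  Nothing of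
Bałaban's; nothing about gauge fields yet; (APE) NOT proved; NE7 NOT PRINTED ∕ NOT PROVED; spine 0∕9; finite T⁴ rung (B)+1
— NOT infinite volume, NOT mass gap, NOT Clay.  No `sorry`.  PLACEMENT: our lemma, under `Summits/QuantumFields/BalabanUV/`.
Continuum YM on T⁴ ⇐ BetaPertH ∧ nine spine estimates (0/9 proved); BetaPertH ⇐ (D1) ∧ (D4) ∧ CAP+tail; G-an2-4 gates asym, D1 and NE2/3/4.
-/

set_option autoImplicit false

open NormedSpace

namespace Summit.QuantumFields.BalabanUV.T4Continuum.NE7GeodesicParameter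

open Literature.MathematicalPhysics.QuantumFieldTheory.Balaban1983to89
open MatrixLog B7Prop1Explicit B7Prop2Explicit UnitaryRootInterpolation UnitaryGeodesic NE7ExpLogSecondOrder
  NE7GeodesicSecondOrder SmoothRefineBlocks

noncomputable section

section UnitaryGeo

variable {𝔸 : Type*} [CStarAlgebra 𝔸] [Nontrivial 𝔸]

/-! ## §1 The parameter direction of the geodesic -/

/-- The ratio `R = b₀⁻¹b₁` of unitaries is unitary, and so are its powers (`‖b₁ − b₀‖ ≤ 1∕4`). [folklore] -/
theorem norm_upow_ratio {b₀ b₁ : 𝔸ˣ} (h₀ : b₀ ∈ unitaryUnits 𝔸) (h₁ : b₁ ∈ unitaryUnits 𝔸)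
    (h : ‖(b₁ : 𝔸) - b₀‖ ≤ 1 / 4) (t : ℝ) : ‖upow t ((b₀⁻¹ * b₁ : 𝔸ˣ) : 𝔸)‖ = 1 := by
  have hR : (b₀⁻¹ * b₁) ∈ unitaryUnits 𝔸 := (unitaryUnits 𝔸).mul_mem ((unitaryUnits 𝔸).inv_mem h₀) h₁
  have hu := upow_mem_unitary (mem_unitaryUnits.mp hR) (by rw [norm_ratio_sub_one h₀]; exact h) t
  exact CStarRing.norm_of_mem_unitary hu

omit [Nontrivial 𝔸] in
/-- **PARAMETER STEP**: `geo s′ b₀ b₁ − geo s b₀ b₁ = geo s b₀ b₁ · ((b₀⁻¹b₁)^{s′−s} − 1)`, hence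
`‖geo s′ − geo s‖ ≤ 4|s′ − s|·ρ` for unitaries with `‖b₁ − b₀‖ ≤ ρ ≤ 1∕4`. [folklore] -/
theorem norm_geo_param_sub_le {b₀ b₁ : 𝔸ˣ} (h₀ : b₀ ∈ unitaryUnits 𝔸) (h₁ : b₁ ∈ unitaryUnits 𝔸) {ρ : ℝ}
    (hρ : ρ ≤ 1 / 4) (hb : ‖(b₁ : 𝔸) - b₀‖ ≤ ρ) {s s' : ℝ} (hss : |s' - s| ≤ 1) :
    ‖(geo s' b₀ b₁ : 𝔸) - geo s b₀ b₁‖ ≤ 4 * |s' - s| * ρ := by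
  have hρ0 : 0 ≤ ρ := (norm_nonneg _).trans hb
  have hid : (geo s' b₀ b₁ : 𝔸) - geo s b₀ b₁ = (geo s b₀ b₁ : 𝔸) * (upow (s' - s) ((b₀⁻¹ * b₁ : 𝔸ˣ) : 𝔸) - 1) := by
    have h := geo_inv_mul_geo_add s (s' - s) b₀ b₁
    rw [show s + (s' - s) = s' by ring] at h
    have h' : (geo s' b₀ b₁ : 𝔸) = (geo s b₀ b₁ : 𝔸) * upow (s' - s) ((b₀⁻¹ * b₁ : 𝔸ˣ) : 𝔸) := by
      rw [← val_upowUnit, ← Units.val_mul, ← h, mul_inv_cancel_left]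
    rw [h', mul_sub, mul_one]
  have hg := geo_mem_unitaryUnits h₀ h₁ (hb.trans hρ) s
  rw [hid, CStarRing.norm_mem_unitary_mul _ (mem_unitaryUnits.mp hg)]
  exact norm_upow_sub_one_le_lin (norm_ratio_sub_one_le h₀ hb) (by linarith) (by nlinarith [abs_nonneg (s' - s)])

omit [Nontrivial 𝔸] in
/-- The parameter step as a product: `geo s′ = geo s · (b₀⁻¹b₁)^{s′−s}`. [folklore] -/
theorem geo_eq_geo_mul_upow (s s' : ℝ) (b₀ b₁ : 𝔸ˣ) :
    (geo s' b₀ b₁ : 𝔸) = (geo s b₀ b₁ : 𝔸) * upow (s' - s) ((b₀⁻¹ * b₁ : 𝔸ˣ) : 𝔸) := by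
  have h := geo_inv_mul_geo_add s (s' - s) b₀ b₁
  rw [show s + (s' - s) = s' by ring] at h
  rw [← val_upowUnit, ← Units.val_mul, ← h, mul_inv_cancel_left]

/-- **THREE-PARAMETER SECOND DIFFERENCE** (same unitary endpoints, `‖b₁ − b₀‖ ≤ ρ ≤ 1∕4`): for steps `b = s′ − s`,
`a = s″ − s′` with `|b| ≤ 1`, `|a − b| ≤ 2`,
`‖(geo s″ − geo s′) − (geo s′ − geo s)‖ ≤ 4|a − b|·ρ + (4|b|ρ)²` (`R^a − R^b = R^b(R^{a−b} − 1)`). [folklore] -/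
theorem norm_geo_param_pg_le {b₀ b₁ : 𝔸ˣ} (h₀ : b₀ ∈ unitaryUnits 𝔸) (h₁ : b₁ ∈ unitaryUnits 𝔸) {ρ : ℝ}
    (hρ : ρ ≤ 1 / 4) (hb : ‖(b₁ : 𝔸) - b₀‖ ≤ ρ) {s s' s'' : ℝ} (h1 : |s' - s| ≤ 1)
    (h3 : |s'' - s' - (s' - s)| ≤ 2) :
    ‖(geo s'' b₀ b₁ : 𝔸) - geo s' b₀ b₁ - (geo s' b₀ b₁ - geo s b₀ b₁)‖
      ≤ 4 * |s'' - s' - (s' - s)| * ρ + (4 * |s' - s| * ρ) ^ 2 := by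
  have hρ0 : 0 ≤ ρ := (norm_nonneg _).trans hb
  obtain ⟨R, hRdef⟩ : ∃ R : 𝔸, R = ((b₀⁻¹ * b₁ : 𝔸ˣ) : 𝔸) := ⟨_, rfl⟩
  have hR : ‖R - 1‖ ≤ ρ := hRdef ▸ norm_ratio_sub_one_le h₀ hb
  have hg : ∀ t : ℝ, ‖(geo t b₀ b₁ : 𝔸)‖ = 1 := fun t =>
    CStarRing.norm_of_mem_unitary (mem_unitaryUnits.mp (geo_mem_unitaryUnits h₀ h₁ (hb.trans hρ) t))
  have hsmall : ∀ {t : ℝ}, |t| ≤ 2 → ‖upow t R - 1‖ ≤ 4 * |t| * ρ := fun {t} ht =>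
    norm_upow_sub_one_le_lin hR (by linarith) (by nlinarith [abs_nonneg t])
  have hid : (geo s'' b₀ b₁ : 𝔸) - geo s' b₀ b₁ - (geo s' b₀ b₁ - geo s b₀ b₁)
      = (geo s' b₀ b₁ : 𝔸) * (upow (s' - s) R * (upow (s'' - s' - (s' - s)) R - 1))
        + ((geo s' b₀ b₁ : 𝔸) - geo s b₀ b₁) * (upow (s' - s) R - 1) := by
    have hs'' : (geo s'' b₀ b₁ : 𝔸) = (geo s' b₀ b₁ : 𝔸) * upow (s'' - s') R := by
      rw [hRdef]; exact geo_eq_geo_mul_upow s' s'' b₀ b₁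
    have hs' : (geo s' b₀ b₁ : 𝔸) = (geo s b₀ b₁ : 𝔸) * upow (s' - s) R := by
      rw [hRdef]; exact geo_eq_geo_mul_upow s s' b₀ b₁
    have hUa : upow (s'' - s') R = upow (s' - s) R * upow (s'' - s' - (s' - s)) R := by
      rw [← upow_add]; congr 1; ring
    rw [hs'', hUa, hs']
    noncomm_ring
  have hRu : ‖upow (s' - s) R‖ = 1 := hRdef ▸ norm_upow_ratio h₀ h₁ (hb.trans hρ) _
  rw [hid]
  refine (norm_add_le _ _).trans (add_le_add ?_ ?_)
  · rw [CStarRing.norm_mem_unitary_mul _ (mem_unitaryUnits.mp (geo_mem_unitaryUnits h₀ h₁ (hb.trans hρ) s'))]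
    calc ‖upow (s' - s) R * (upow (s'' - s' - (s' - s)) R - 1)‖
        ≤ ‖upow (s' - s) R‖ * ‖upow (s'' - s' - (s' - s)) R - 1‖ := norm_mul_le _ _
      _ ≤ 1 * (4 * |s'' - s' - (s' - s)| * ρ) := by rw [hRu]; exact mul_le_mul_of_nonneg_left (hsmall h3) zero_le_one
      _ = 4 * |s'' - s' - (s' - s)| * ρ := one_mul _
  · calc ‖((geo s' b₀ b₁ : 𝔸) - geo s b₀ b₁) * (upow (s' - s) R - 1)‖
        ≤ ‖(geo s' b₀ b₁ : 𝔸) - geo s b₀ b₁‖ * ‖upow (s' - s) R - 1‖ := norm_mul_le _ _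
      _ ≤ (4 * |s' - s| * ρ) * (4 * |s' - s| * ρ) :=
          mul_le_mul (norm_geo_param_sub_le h₀ h₁ hρ hb h1) (hsmall (h1.trans one_le_two)) (norm_nonneg _) (by positivity)
      _ = (4 * |s' - s| * ρ) ^ 2 := (sq _).symm

/-- **MIXED SECOND DIFFERENCE** (one parameter step `b = s′ − s`, `|b| ≤ 1`, one endpoint step): for unitary endpoint pairs
`(b₀, b₁)`, `(b₀′, b₁′)` with `‖b₁ − b₀‖, ‖b₁′ − b₀′‖ ≤ ρ ≤ 1∕4`, endpoint displacements `≤ l`, and `0 ≤ s ≤ 1`: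
`‖(geo s′ b′ − geo s b′) − (geo s′ b − geo s b)‖ ≤ |b|·l·(4ρ(1 + 24ρ) + 8)`. [folklore] -/
theorem norm_geo_mixed_pg_le {b₀ b₁ b₀' b₁' : 𝔸ˣ} (h₀ : b₀ ∈ unitaryUnits 𝔸) (h₁ : b₁ ∈ unitaryUnits 𝔸)
    (h₀' : b₀' ∈ unitaryUnits 𝔸) {ρ s s' l : ℝ} (hρ : ρ ≤ 1 / 4)
    (hb : ‖(b₁ : 𝔸) - b₀‖ ≤ ρ) (hb' : ‖(b₁' : 𝔸) - b₀'‖ ≤ ρ) (hs0 : 0 ≤ s) (hs1 : s ≤ 1) (hss : |s' - s| ≤ 1)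
    (hl₀ : ‖(b₀' : 𝔸) - b₀‖ ≤ l) (hl₁ : ‖(b₁' : 𝔸) - b₁‖ ≤ l) :
    ‖((geo s' b₀' b₁' : 𝔸) - geo s b₀' b₁') - ((geo s' b₀ b₁ : 𝔸) - geo s b₀ b₁)‖
      ≤ |s' - s| * l * (4 * ρ * (1 + 24 * ρ) + 8) := by
  have hρ0 : 0 ≤ ρ := (norm_nonneg _).trans hb
  have hl0 : 0 ≤ l := (norm_nonneg _).trans hl₀
  obtain ⟨R, hRdef⟩ : ∃ R : 𝔸, R = ((b₀⁻¹ * b₁ : 𝔸ˣ) : 𝔸) := ⟨_, rfl⟩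
  obtain ⟨R', hR'def⟩ : ∃ R' : 𝔸, R' = ((b₀'⁻¹ * b₁' : 𝔸ˣ) : 𝔸) := ⟨_, rfl⟩
  have hR : ‖R - 1‖ ≤ ρ := hRdef ▸ norm_ratio_sub_one_le h₀ hb
  have hR' : ‖R' - 1‖ ≤ ρ := hR'def ▸ norm_ratio_sub_one_le h₀' hb'
  have e1 : (geo s' b₀' b₁' : 𝔸) - geo s b₀' b₁' = (geo s b₀' b₁' : 𝔸) * (upow (s' - s) R' - 1) := by
    rw [hR'def, geo_eq_geo_mul_upow s s', mul_sub, mul_one]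
  have e2 : (geo s' b₀ b₁ : 𝔸) - geo s b₀ b₁ = (geo s b₀ b₁ : 𝔸) * (upow (s' - s) R - 1) := by
    rw [hRdef, geo_eq_geo_mul_upow s s', mul_sub, mul_one]
  have hid : ((geo s' b₀' b₁' : 𝔸) - geo s b₀' b₁') - ((geo s' b₀ b₁ : 𝔸) - geo s b₀ b₁)
      = ((geo s b₀' b₁' : 𝔸) - geo s b₀ b₁) * (upow (s' - s) R' - 1) + (geo s b₀ b₁ : 𝔸) * (upow (s' - s) R' - upow (s' - s) R) := by
    rw [e1, e2]; noncomm_ring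
  have hgeo := norm_geo_sub_geo_sharp' h₀ h₁ h₀' hρ hb hb' hs0 hs1 hl₀ hl₁
  have hRR : ‖R' - R‖ ≤ l + l := by
    rw [hRdef, hR'def]
    exact (norm_ratio_sub_ratio_le (b₀ := b₀') (b₁ := b₁') (b₀' := b₀) (b₁' := b₁) h₀' h₀ h₁).trans (add_le_add hl₀ hl₁)
  have hup : ‖upow (s' - s) R' - upow (s' - s) R‖ ≤ 2 * |s' - s| * Real.exp (|s' - s| * (2 * ρ)) * ‖R' - R‖ :=
    norm_upow_sub_upow_le (by linarith) hR' hR _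
  have he : Real.exp (|s' - s| * (2 * ρ)) ≤ 2 := by
    have h1 : Real.exp (|s' - s| * (2 * ρ)) ≤ Real.exp (1 / 2 : ℝ) := Real.exp_le_exp.mpr (by nlinarith [abs_nonneg (s' - s)])
    linarith [real_exp_half_le]
  have hsmall : ‖upow (s' - s) R' - 1‖ ≤ 4 * |s' - s| * ρ :=
    norm_upow_sub_one_le_lin hR' (by linarith) (by nlinarith [abs_nonneg (s' - s)])
  rw [hid]
  refine (norm_add_le _ _).trans ?_
  have hg1 : ‖(geo s b₀ b₁ : 𝔸)‖ = 1 :=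
    CStarRing.norm_of_mem_unitary (mem_unitaryUnits.mp (geo_mem_unitaryUnits h₀ h₁ (hb.trans hρ) s))
  have t1 : ‖((geo s b₀' b₁' : 𝔸) - geo s b₀ b₁) * (upow (s' - s) R' - 1)‖ ≤ ((1 + 24 * s * ρ) * l) * (4 * |s' - s| * ρ) :=
    (norm_mul_le _ _).trans (mul_le_mul hgeo hsmall (norm_nonneg _) (by positivity))
  have t2 : ‖(geo s b₀ b₁ : 𝔸) * (upow (s' - s) R' - upow (s' - s) R)‖ ≤ 2 * |s' - s| * 2 * (l + l) := by
    rw [CStarRing.norm_mem_unitary_mul _ (mem_unitaryUnits.mp (geo_mem_unitaryUnits h₀ h₁ (hb.trans hρ) s))]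
    calc ‖upow (s' - s) R' - upow (s' - s) R‖ ≤ 2 * |s' - s| * Real.exp (|s' - s| * (2 * ρ)) * ‖R' - R‖ := hup
      _ ≤ 2 * |s' - s| * 2 * (l + l) := by gcongr
  have habs : 0 ≤ |s' - s| := abs_nonneg _
  have t1' : ((1 + 24 * s * ρ) * l) * (4 * |s' - s| * ρ) ≤ ((1 + 24 * ρ) * l) * (4 * |s' - s| * ρ) := by
    refine mul_le_mul_of_nonneg_right (mul_le_mul_of_nonneg_right ?_ hl0) (by positivity)
    nlinarith
  have key : ((1 + 24 * ρ) * l) * (4 * |s' - s| * ρ) + 2 * |s' - s| * 2 * (l + l)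
      = |s' - s| * l * (4 * ρ * (1 + 24 * ρ) + 8) := by ring
  linarith [t1, t1', t2, key]

end UnitaryGeo

/-! ## §2 The smoothstep `φ(t) = 3t² − 2t³` -/

section Smoothstep

/-- `0 ≤ 3t² − 2t³` and `3t² − 2t³ ≤ 1` on `[0,1]`. [folklore] -/
theorem sstep_mem {t : ℝ} (h0 : 0 ≤ t) (h1 : t ≤ 1) : 0 ≤ 3 * t ^ 2 - 2 * t ^ 3 ∧ 3 * t ^ 2 - 2 * t ^ 3 ≤ 1 := by
  constructor <;> nlinarith [mul_nonneg h0 h0, mul_nonneg (mul_nonneg h0 h0) h0, mul_nonneg (mul_nonneg h0 h0) (sub_nonneg.2 h1),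
    mul_nonneg (sub_nonneg.2 h1) (sub_nonneg.2 h1), mul_nonneg (mul_nonneg (sub_nonneg.2 h1) (sub_nonneg.2 h1)) h0]

/-- **Monotone and `3∕2`-Lipschitz**: `0 ≤ φ t′ − φ t ≤ (3∕2)(t′ − t)` for `0 ≤ t ≤ t′ ≤ 1`
(`φ t′ − φ t = (t′−t)·q`, `q = 3(t+t′) − 2(t² + tt′ + t′²) ∈ [0, 3∕2]` since `3∕2 − q = (t+t′−1)² + (t−½)² + (t′−½)²`). [folklore] -/
theorem sstep_sub_mem {t t' : ℝ} (h0 : 0 ≤ t) (htt : t ≤ t') (h1 : t' ≤ 1) :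
    0 ≤ (3 * t' ^ 2 - 2 * t' ^ 3) - (3 * t ^ 2 - 2 * t ^ 3)
      ∧ (3 * t' ^ 2 - 2 * t' ^ 3) - (3 * t ^ 2 - 2 * t ^ 3) ≤ 3 / 2 * (t' - t) := by
  have hq : (3 * t' ^ 2 - 2 * t' ^ 3) - (3 * t ^ 2 - 2 * t ^ 3) = (t' - t) * (3 * (t + t') - 2 * (t ^ 2 + t * t' + t' ^ 2)) := by
    ring
  have hd : 0 ≤ t' - t := sub_nonneg.2 htt
  constructor
  · rw [hq]
    refine mul_nonneg hd ?_
    nlinarith [mul_nonneg h0 (sub_nonneg.2 h1), mul_nonneg h0 hd, mul_nonneg hd (sub_nonneg.2 h1)]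
  · rw [hq]
    have : 3 * (t + t') - 2 * (t ^ 2 + t * t' + t' ^ 2) ≤ 3 / 2 := by
      nlinarith [sq_nonneg (t + t' - 1), sq_nonneg (t - 1 / 2), sq_nonneg (t' - 1 / 2)]
    nlinarith

/-- **Second differences**: `φ(t+h) − 2φ(t) + φ(t−h) = 6h²(1 − 2t)`, so `|…| ≤ 6h²` for `0 ≤ t ≤ 1`. [folklore] -/
theorem sstep_second_diff_le {t h : ℝ} (h0 : 0 ≤ t) (h1 : t ≤ 1) :
    |(3 * (t + h) ^ 2 - 2 * (t + h) ^ 3) - (3 * t ^ 2 - 2 * t ^ 3) - ((3 * t ^ 2 - 2 * t ^ 3) - (3 * (t - h) ^ 2 - 2 * (t - h) ^ 3))|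
      ≤ 6 * h ^ 2 := by
  have hid : (3 * (t + h) ^ 2 - 2 * (t + h) ^ 3) - (3 * t ^ 2 - 2 * t ^ 3) - ((3 * t ^ 2 - 2 * t ^ 3) - (3 * (t - h) ^ 2 - 2 * (t - h) ^ 3))
      = 6 * h ^ 2 * (1 - 2 * t) := by ring
  rw [hid, abs_mul, abs_of_nonneg (by positivity : (0:ℝ) ≤ 6 * h ^ 2)]
  have : |1 - 2 * t| ≤ 1 := abs_le.2 ⟨by linarith, by linarith⟩
  nlinarith [sq_nonneg h]

/-- **Flat ends**: `φ h ≤ 3h²` and `1 − φ(1 − h) ≤ 3h²` for `0 ≤ h` (`φ′(0) = φ′(1) = 0`; `1 − φ(1−h) = 3h² − 2h³`). [folklore] -/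
theorem sstep_ends {h : ℝ} (h0 : 0 ≤ h) :
    3 * h ^ 2 - 2 * h ^ 3 ≤ 3 * h ^ 2 ∧ 1 - (3 * (1 - h) ^ 2 - 2 * (1 - h) ^ 3) ≤ 3 * h ^ 2 := by
  constructor
  · nlinarith [pow_nonneg h0 3]
  · nlinarith [pow_nonneg h0 3]

/-- **Lattice form of the Lipschitz bound**: for integers `0 ≤ r`, `r + 1 ≤ M`, with `t = r∕M`, `t′ = (r+1)∕M`:
`|φ t′ − φ t| ≤ 3∕(2M)` and `|φ t′ − φ t| ≤ 1`. [folklore] -/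
theorem sstep_step_le {M : ℕ} (hM : 1 ≤ M) {r : ℤ} (hr0 : 0 ≤ r) (hrM : r + 1 ≤ (M : ℤ)) :
    |(3 * (((r + 1 : ℤ) : ℝ) / M) ^ 2 - 2 * (((r + 1 : ℤ) : ℝ) / M) ^ 3) - (3 * ((r : ℝ) / M) ^ 2 - 2 * ((r : ℝ) / M) ^ 3)|
        ≤ 3 / 2 / (M : ℝ)
      ∧ |(3 * (((r + 1 : ℤ) : ℝ) / M) ^ 2 - 2 * (((r + 1 : ℤ) : ℝ) / M) ^ 3) - (3 * ((r : ℝ) / M) ^ 2 - 2 * ((r : ℝ) / M) ^ 3)| ≤ 1 := by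
  have hM0 : (0 : ℝ) < M := by exact_mod_cast hM
  have hr0' : (0 : ℝ) ≤ (r : ℝ) / M := div_nonneg (by exact_mod_cast hr0) hM0.le
  have hle : (r : ℝ) / M ≤ ((r + 1 : ℤ) : ℝ) / M := by
    gcongr; linarith
  have h1 : ((r + 1 : ℤ) : ℝ) / M ≤ 1 := by
    rw [div_le_one hM0]; exact_mod_cast hrM
  have h := sstep_sub_mem hr0' hle h1
  have hdiff : ((r + 1 : ℤ) : ℝ) / M - (r : ℝ) / M = 1 / M := by push_cast; field_simp; ring
  rw [abs_of_nonneg h.1]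
  constructor
  · calc _ ≤ 3 / 2 * (((r + 1 : ℤ) : ℝ) / M - (r : ℝ) / M) := h.2
      _ = 3 / 2 / (M : ℝ) := by rw [hdiff]; ring
  · have hb := (sstep_mem hr0' (hle.trans h1)).1
    have hb' := (sstep_mem (hr0'.trans hle) h1).2
    linarith

/-- **Lattice form of the flat ends**: with `t = r∕M`, if `r = 0` or `r + 1 = M` then `|φ((r+1)∕M) − φ(r∕M)| ≤ 3∕M²`. [folklore] -/
theorem sstep_step_end_le {M : ℕ} (hM : 1 ≤ M) {r : ℤ} (hr : r = 0 ∨ r + 1 = (M : ℤ)) (hr0 : 0 ≤ r) (hrM : r + 1 ≤ (M : ℤ)) :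
    |(3 * (((r + 1 : ℤ) : ℝ) / M) ^ 2 - 2 * (((r + 1 : ℤ) : ℝ) / M) ^ 3) - (3 * ((r : ℝ) / M) ^ 2 - 2 * ((r : ℝ) / M) ^ 3)|
      ≤ 3 / (M : ℝ) ^ 2 := by
  have hM0 : (0 : ℝ) < M := by exact_mod_cast hM
  have hM1 : (1 : ℝ) ≤ M := by exact_mod_cast hM
  have hr0' : (0 : ℝ) ≤ (r : ℝ) / M := div_nonneg (by exact_mod_cast hr0) hM0.le
  have hle : (r : ℝ) / M ≤ ((r + 1 : ℤ) : ℝ) / M := by gcongr; linarith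
  have h1 : ((r + 1 : ℤ) : ℝ) / M ≤ 1 := by rw [div_le_one hM0]; exact_mod_cast hrM
  rw [abs_of_nonneg (sstep_sub_mem hr0' hle h1).1]
  have hinv : (0 : ℝ) ≤ 1 / M := by positivity
  have hends := sstep_ends hinv
  rcases hr with h | h
  · subst h
    have e1 : (((0 : ℤ) + 1 : ℤ) : ℝ) / M = 1 / M := by push_cast; ring
    have e0 : (((0 : ℤ) : ℤ) : ℝ) / (M : ℝ) = 0 := by push_cast; ring
    rw [e1, e0]
    calc 3 * (1 / (M : ℝ)) ^ 2 - 2 * (1 / (M : ℝ)) ^ 3 - (3 * (0 : ℝ) ^ 2 - 2 * (0 : ℝ) ^ 3)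
        = 3 * (1 / (M : ℝ)) ^ 2 - 2 * (1 / (M : ℝ)) ^ 3 := by ring
      _ ≤ 3 * (1 / (M : ℝ)) ^ 2 := hends.1
      _ = 3 / (M : ℝ) ^ 2 := by field_simp
  · have e1 : (((r + 1 : ℤ)) : ℝ) / M = 1 := by rw [h]; push_cast; field_simp
    have e0 : (r : ℝ) / M = 1 - 1 / M := by
      have : (r : ℝ) = (M : ℝ) - 1 := by
        have := congrArg (fun z : ℤ => (z : ℝ)) h; push_cast at this; linarith
      rw [this]; field_simp
    rw [e1, e0]
    calc 3 * (1 : ℝ) ^ 2 - 2 * (1 : ℝ) ^ 3 - (3 * (1 - 1 / (M : ℝ)) ^ 2 - 2 * (1 - 1 / (M : ℝ)) ^ 3)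
        = 1 - (3 * (1 - 1 / (M : ℝ)) ^ 2 - 2 * (1 - 1 / (M : ℝ)) ^ 3) := by ring
      _ ≤ 3 * (1 / (M : ℝ)) ^ 2 := hends.2
      _ = 3 / (M : ℝ) ^ 2 := by field_simp

/-- **Lattice form of the second difference**: for `0 ≤ r`, `r + 2 ≤ M`:
`|(φ((r+2)∕M) − φ((r+1)∕M)) − (φ((r+1)∕M) − φ(r∕M))| ≤ 6∕M²`. [folklore] -/
theorem sstep_lattice_second_diff_le {M : ℕ} (hM : 1 ≤ M) {r : ℤ} (hr0 : 0 ≤ r) (hrM : r + 2 ≤ (M : ℤ)) :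
    |(3 * (((r + 2 : ℤ) : ℝ) / M) ^ 2 - 2 * (((r + 2 : ℤ) : ℝ) / M) ^ 3) - (3 * (((r + 1 : ℤ) : ℝ) / M) ^ 2 - 2 * (((r + 1 : ℤ) : ℝ) / M) ^ 3)
      - ((3 * (((r + 1 : ℤ) : ℝ) / M) ^ 2 - 2 * (((r + 1 : ℤ) : ℝ) / M) ^ 3) - (3 * ((r : ℝ) / M) ^ 2 - 2 * ((r : ℝ) / M) ^ 3))|
      ≤ 6 / (M : ℝ) ^ 2 := by
  have hM0 : (0 : ℝ) < M := by exact_mod_cast hM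
  have ht0 : (0 : ℝ) ≤ ((r + 1 : ℤ) : ℝ) / M := div_nonneg (by push_cast; exact_mod_cast (by linarith : (0:ℤ) ≤ r + 1)) hM0.le
  have ht1 : ((r + 1 : ℤ) : ℝ) / M ≤ 1 := by rw [div_le_one hM0]; exact_mod_cast (by linarith : r + 1 ≤ (M : ℤ))
  have h := sstep_second_diff_le (h := 1 / (M : ℝ)) ht0 ht1
  have e2 : ((r + 1 : ℤ) : ℝ) / M + 1 / M = ((r + 2 : ℤ) : ℝ) / M := by push_cast; field_simp; ring
  have e0 : ((r + 1 : ℤ) : ℝ) / M - 1 / M = (r : ℝ) / M := by push_cast; field_simp; ring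
  rw [e2, e0] at h
  calc _ ≤ 6 * (1 / (M : ℝ)) ^ 2 := h
    _ = 6 / (M : ℝ) ^ 2 := by field_simp

end Smoothstep

/-! ## §3 Block floors `fl_j y = y − (res M y j)•e_j` -/

section Floors

variable {d : ℕ}

/-- The floor of `y` in direction `j` (drop the offset `res M y j ∈ [0, M)`), written out: `y − (res M y j) • e j`.
At a unit step in another direction the floor moves with the step. [folklore] -/
theorem floor_add_e_ne {M : ℕ} (hM : 1 ≤ M) (y : Site d) {j μ : Fin d} (h : μ ≠ j) :
    (y + e μ) - (res M (y + e μ) j) • e j = (y - (res M y j) • e j) + e μ := by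
  rw [res_add_e_ne hM y h.symm]; abel

/-- A unit step in direction `j` inside a block keeps the floor. [folklore] -/
theorem floor_add_e_self_of_ne {M : ℕ} (hM : 1 ≤ M) (y : Site d) (j : Fin d) (h : res M y j ≠ (M : ℤ) - 1) :
    (y + e j) - (res M (y + e j) j) • e j = y - (res M y j) • e j := by
  rw [res_add_e_self hM y j, if_neg h, add_smul, one_smul]; abel

/-- A unit step in direction `j` out of a block moves the floor by `M•e_j`. [folklore] -/
theorem floor_add_e_self_of_eq {M : ℕ} (hM : 1 ≤ M) (y : Site d) (j : Fin d) (h : res M y j = (M : ℤ) - 1) :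
    (y + e j) - (res M (y + e j) j) • e j = (y - (res M y j) • e j) + (M : ℤ) • e j := by
  rw [res_add_e_self hM y j, if_pos h, h, zero_smul, sub_zero, sub_smul, one_smul]; abel

/-- A coarse translation by `P` blocks in any direction `κ` moves the floor with it. [folklore] -/
theorem floor_add_period {M : ℕ} (hM : 1 ≤ M) (y : Site d) (j κ : Fin d) (P : ℤ) :
    (y + ((M : ℤ) * P) • e κ) - (res M (y + ((M : ℤ) * P) • e κ) j) • e j = (y - (res M y j) • e j) + ((M : ℤ) * P) • e κ := by
  rw [(blk_res_add_period hM y P κ).2]; abel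

/-- At a corner `M•z` the floor is the corner and the offset vanishes. [folklore] -/
theorem floor_corner {M : ℕ} (hM : 1 ≤ M) (z : Site d) (j : Fin d) :
    res M ((M : ℤ) • z) j = 0 ∧ ((M : ℤ) • z) - (res M ((M : ℤ) • z) j) • e j = (M : ℤ) • z := by
  have h := (blk_res_smul hM z).2
  refine ⟨by rw [h]; rfl, by rw [h]; simp⟩

/-- Flooring in direction `κ` keeps the block and the other offsets: `blk M (y − (res M y κ)•e_κ) = blk M y` and
`res M (y − (res M y κ)•e_κ) = res M y − (res M y κ)•e_κ`. [folklore] -/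
theorem blk_res_floor {M : ℕ} (hM : 1 ≤ M) (y : Site d) (κ : Fin d) :
    blk M (y - (res M y κ) • e κ) = blk M y ∧ res M (y - (res M y κ) • e κ) = res M y - (res M y κ) • e κ := by
  have hb := blk_add_res M y
  have hdec : (M : ℤ) • blk M y + (res M y - (res M y κ) • e κ) = y - (res M y κ) • e κ := by rw [← add_sub_assoc, hb]
  refine blk_res_eq_of hM hdec (fun i => ?_) (fun i => ?_)
  · simp only [Pi.sub_apply, Pi.smul_apply, e_apply, smul_eq_mul]
    split_ifs with hi
    · subst hi; simp
    · simp only [mul_zero, sub_zero]; exact res_nonneg hM y i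
  · simp only [Pi.sub_apply, Pi.smul_apply, e_apply, smul_eq_mul]
    split_ifs with hi
    · subst hi; simp only [mul_one, sub_self]; exact_mod_cast (by omega : 0 < M)
    · simp only [mul_zero, sub_zero]; exact res_lt hM y i

/-- In particular the `j`-offset is unchanged by flooring in another direction `κ ≠ j`. [folklore] -/
theorem res_floor_ne {M : ℕ} (hM : 1 ≤ M) (y : Site d) {j κ : Fin d} (h : j ≠ κ) :
    res M (y - (res M y κ) • e κ) j = res M y j := by
  rw [(blk_res_floor hM y κ).2]; simp [e_apply, h]

end Floors

end

end Summit.QuantumFields.BalabanUV.T4Continuum.NE7GeodesicParameter
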